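import Literature.NumberTheory.Sieve.McCurleyCoveringRough
import Literature.NumberTheory.Sieve.PowerResidueClasses
import Literature.NumberTheory.Sieve.PowerResidueMertens
import Literature.NumberTheory.Sieve.RankinSmoothBound
import Mathlib.NumberTheory.Bertrand
import HarnessLib

/-!
# McCurley's covering theorem: `mⁿ + a ≡ 0 (mod p)`, `p ≤ w`, for all `0 ≤ m ≤ α (w/log₂ w)(log w log₃ w/log₂ w)^{d(n)}`

Topic `Literature/NumberTheory/Sieve`. Everything in this file is PROVED.

The sieve-theoretic core of K. S. McCurley, *The smallest prime value of `xⁿ + a`*,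
Can. J. Math. 38 (1986), Theorem 3 (§4, pp. 932–934), generalising Rankin's 1938 construction of
long gaps between primes (`n = 1`): for every `n ≥ 1` there is `α = α(n) > 0` such that for all
sufficiently large `w` one can choose a residue `c_p (mod p)` for each prime `p ≤ w` so that every
integer `0 ≤ m ≤ α (w/log₂ w)(log w log₃ w/log₂ w)^{d(n)}` satisfies `mⁿ + c_p ≡ 0 (mod p)` for
some prime `p ≤ w` (`Literature.NumberTheory.Sieve.McCurley.exists_powClasses_cover`). Choosing `a ≡ c_p (mod p)` by
the Chinese remainder theorem then makes `mⁿ + a` composite on that whole initial range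
(`Literature/Barriers/Parity/LeastPrimeValueProofs.lean`).

Proof (McCurley, §4; `L = log w`, `T = log₂ w`, `d = d(n)`): with
`u = ⌊α (w/T)(L log T/T)^d⌋`, `y = ⌊exp(L log T/((d+8) T))⌋`, `z = ⌊w/4⌋`,
1. the *medium* primes `y < p ≤ z` get `c_p = 0`; an `m ≤ u` they do not cover is `≥ 1` and
   either `y`-smooth — at most `w/(16 L)` of them by Rankin's method
   (`Literature.NumberTheory.Sieve.card_smoothNumbersUpTo_le_rankin_exp`, `Literature.NumberTheory.Sieve.McCurley.smoothFactor_le`;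
   McCurley quotes de Bruijn) — or divisible by a prime `> z` — at most `u (2d+2) T/L` of them
   by Mertens' theorem (`Literature.NumberTheory.Sieve.McCurley.card_rough_le`);
2. the *small* primes `p ≤ y` are used greedily on the classes of `mⁿ (mod p)`
   (`Literature.NumberTheory.Sieve.exists_powClasses_card_filter_le`), leaving a fraction
   `∏_{p ≤ y} (p−1)/(p−1+(p−1,n)) ≤ C/(log y)^d` (`Literature.NumberTheory.Sieve.prod_primesLE_powClassFactor_le`,
   McCurley's Lemma 5) of the survivors, i.e. at most `w/(16 L) + α K w/L ≤ w/(8 L)`;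
3. the *large* primes `z < p ≤ w`, at least `w/(4 L)` in number (Chebyshev), remove the
   remaining `m` one at a time (`Literature.NumberTheory.Sieve.exists_powClasses_of_card_le`).

## References

* K. S. McCurley, Can. J. Math. 38 (1986) 925–936, Theorem 3 and §4. [McCurley1986SmallestPrimeValue]
* R. A. Rankin, *The difference between consecutive prime numbers*, J. London Math. Soc. 13
  (1938) 242–247 (the case `n = 1`).
-/

open Finset Filter Real

namespace Literature.NumberTheory.Sieve.McCurley

set_option maxHeartbeats 400000 in
/-- **McCurley's covering theorem** (the core of Theorem 3 of *The smallest prime value of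
`xⁿ + a`*; Rankin's method with `n`-th power classes). For every `n ≥ 1` there is `α > 0` such
that for all sufficiently large `w` there are residues `c p`, one for each prime `p ≤ w`, such that
every integer `0 ≤ m ≤ α (w/log₂ w)(log w · log₃ w/log₂ w)^{d(n)}` satisfies
`mⁿ + c p ≡ 0 (mod p)` for some prime `p ≤ w` ("every `m` with `0 ≤ m ≤ u` satisfies at least one
congruence `mⁿ + a ≡ 0 (mod p)` with `p < w`").
[cite: McCurley1986SmallestPrimeValue, Theorem 3 and §4 (pp. 927, 932–934)] -/
theorem exists_powClasses_cover {n : ℕ} (hn : 1 ≤ n) :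
    ∃ α : ℝ, 0 < α ∧ ∀ᶠ w : ℕ in atTop, ∃ c : ℕ → ℕ, ∀ m : ℕ,
      (m : ℝ) ≤ α * ((w : ℝ) / Real.log (Real.log w) *
        (Real.log w * Real.log (Real.log (Real.log w)) / Real.log (Real.log w)) ^ #n.divisors) →
      ∃ p : ℕ, p.Prime ∧ p ≤ w ∧ p ∣ m ^ n + c p := by
  classical
  obtain ⟨C, hC0, hC⟩ := prod_primesLE_powClassFactor_le hn
  set d : ℕ := #n.divisors with hd
  have hd1 : 1 ≤ d := Finset.card_pos.2 ⟨n, Nat.mem_divisors_self n (by omega)⟩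
  have hd0 : (0 : ℝ) ≤ d := Nat.cast_nonneg d
  -- the constant `α`
  set K₁ : ℝ := (2 * d + 2) * C * (2 * ((d : ℝ) + 8)) ^ d with hK₁
  have hK₁0 : 0 < K₁ := by positivity
  set α : ℝ := min 1 (1 / (16 * K₁)) with hα
  have hα0 : 0 < α := lt_min one_pos (by positivity)
  have hα1 : α ≤ 1 := min_le_left _ _
  have hαK : α * K₁ ≤ 1 / 16 := by
    calc α * K₁ ≤ (1 / (16 * K₁)) * K₁ := mul_le_mul_of_nonneg_right (min_le_right _ _) hK₁0.le
      _ = 1 / 16 := by field_simp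
  refine ⟨α, hα0, ?_⟩
  filter_upwards [eventually_loglog d] with w hw
  -- notation
  set L : ℝ := Real.log (w : ℝ) with hL
  set T : ℝ := Real.log L with hT
  obtain ⟨hT19, hb, hηL, h4, h5, hπ⟩ := hw
  set F : ℝ := (w : ℝ) / T * (L * Real.log T / T) ^ d with hF
  set ℓ : ℝ := L * Real.log T / (((d : ℝ) + 8) * T) with hℓ
  set η : ℝ := ((d : ℝ) + 7) * T / L with hη
  obtain ⟨hT0, hlogT1, hlogTT, hexpT, hL200, hexpL, hw200⟩ := basics hL hT hT19
  have hL0 : 0 < L := by linarith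
  have hlogT0 : 0 < Real.log T := by linarith
  obtain ⟨hWF, hFpos, hlogF⟩ := F_bounds hd1 hL hT hT19 h5 hF
  obtain ⟨hℓ2, hℓL⟩ := ell_bounds hT19 hL0 h4 hℓ
  have hℓ0 : 0 < ℓ := by linarith
  obtain ⟨hy2, hlogy, hyexp, h2yz⟩ := y_bounds hL hL200 hℓ2 hℓL
  set y : ℕ := ⌊Real.exp ℓ⌋₊ with hy
  set z : ℕ := w / 4 with hz
  set u : ℕ := ⌊α * F⌋₊ with hu
  -- `u ≤ α F ≤ F`
  have hαF0 : 0 ≤ α * F := by positivity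
  have huαF : (u : ℝ) ≤ α * F := Nat.floor_le hαF0
  have huF : (u : ℝ) ≤ F := huαF.trans (by nlinarith)
  -- the three ranges of primes
  set Ps := Nat.primesLE y with hPs
  set Pm := Nat.primesLE z \ Nat.primesLE y with hPm
  set Pl := Nat.primesLE w \ Nat.primesLE z with hPl
  -- Stage 1: the medium primes get the class `0`
  set R₀ := range (u + 1) with hR₀
  set R₁ := R₀.filter fun m => ∀ p ∈ Pm, ¬ p ∣ m with hR₁
  -- a medium prime exists (Bertrand), so `0 ∉ R₁` and `R₁ ⊆ smooth ∪ rough`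
  obtain ⟨p₀, hp₀, hyp₀, hp₀y⟩ := Nat.exists_prime_lt_and_le_two_mul y (by omega)
  have hp₀m : p₀ ∈ Pm := by
    rw [hPm, Finset.mem_sdiff, Nat.mem_primesLE, Nat.mem_primesLE]
    exact ⟨⟨by omega, hp₀⟩, fun h => by omega⟩
  have hR₁sub : R₁ ⊆ Nat.smoothNumbersUpTo u (y + 1) ∪ Nat.roughNumbersUpTo u (z + 1) := by
    intro m hm
    rw [hR₁, mem_filter, hR₀, mem_range] at hm
    obtain ⟨hmu, hmed⟩ := hm
    have hm0 : m ≠ 0 := fun h => hmed p₀ hp₀m (h ▸ dvd_zero p₀)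
    by_cases hs : m ∈ Nat.smoothNumbers (y + 1)
    · exact mem_union_left _ (Nat.mem_smoothNumbersUpTo.2 ⟨by omega, hs⟩)
    · refine mem_union_right _ ?_
      rw [Nat.roughNumbersUpTo, mem_filter, mem_range]
      refine ⟨by omega, hm0, fun hz' => hs ?_⟩
      rw [Nat.mem_smoothNumbers'] at hz' ⊢
      intro q hq hqm
      have hqz := hz' q hq hqm
      by_contra hqy
      refine hmed q ?_ hqm
      rw [hPm, Finset.mem_sdiff, Nat.mem_primesLE, Nat.mem_primesLE]
      exact ⟨⟨by omega, hq⟩, fun h => hqy (by omega)⟩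
  -- the smooth part
  have hS : (#(Nat.smoothNumbersUpTo u (y + 1)) : ℝ) ≤ (w : ℝ) / (16 * L) := by
    have hk2 : 2 ≤ y + 1 := by omega
    have hk2r : (2 : ℝ) ≤ ((y + 1 : ℕ) : ℝ) := by exact_mod_cast hk2
    have hkr : ((y + 1 : ℕ) : ℝ) ≤ Real.exp ℓ + 1 := by push_cast; linarith
    have hWF' : Real.exp L ≤ F := by rw [hexpL]; exact hWF
    obtain ⟨hη0, hη2, hbound⟩ := smoothFactor_le hT hT19 hb hηL hη hℓ hWF' hlogF hk2r hkr
    have h1 := card_smoothNumbersUpTo_le_rankin_exp u hk2 hη0 hη2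
    have hu0 : (0 : ℝ) ≤ u := Nat.cast_nonneg u
    have h2 : (u : ℝ) ^ (1 - η) ≤ F ^ (1 - η) := Real.rpow_le_rpow hu0 huF (by linarith)
    rw [hexpL] at hbound
    refine h1.trans (le_trans ?_ hbound)
    exact mul_le_mul_of_nonneg_right h2 (Real.exp_pos _).le
  -- the rough part
  have hR : (#(Nat.roughNumbersUpTo u (z + 1)) : ℝ) ≤ u * ((2 * d + 2) * T / L) := by
    by_cases hzu : z < u
    · exact card_rough_le hL hT hT19 hzu huF hlogF
    · have : Nat.roughNumbersUpTo u (z + 1) = ∅ := by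
        rw [Finset.eq_empty_iff_forall_notMem]
        intro m hm
        rw [Nat.roughNumbersUpTo, mem_filter, mem_range] at hm
        obtain ⟨hmu, hm0, hms⟩ := hm
        exact hms (Nat.mem_smoothNumbers_of_lt (by omega) (by omega))
      rw [this, card_empty, Nat.cast_zero]
      positivity
  have hR₁card : (#R₁ : ℝ) ≤ (w : ℝ) / (16 * L) + u * ((2 * d + 2) * T / L) := by
    have h := (card_le_card hR₁sub).trans (card_union_le _ _)
    have h' : (#R₁ : ℝ) ≤ (#(Nat.smoothNumbersUpTo u (y + 1)) : ℝ) +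
        #(Nat.roughNumbersUpTo u (z + 1)) := by exact_mod_cast h
    linarith
  -- Stage 2: greedy on the small primes
  obtain ⟨cs, hcs⟩ := exists_powClasses_card_filter_le R₁ Ps
    (fun p hp => (Nat.mem_primesLE.1 hp).2) hn
  set G : ℝ := ∏ p ∈ Ps, ((p : ℝ) - 1) / ((p : ℝ) - 1 + #((range p).filter fun x => x ^ n % p = 1))
    with hG
  set R₂ := R₁.filter fun m => ∀ p ∈ Ps, ¬ p ∣ m ^ n + cs p with hR₂
  have hG0 : 0 ≤ G := prod_nonneg fun p hp =>
    (powClassFactor_nonneg_le_one (Nat.mem_primesLE.1 hp).2 n).1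
  have hG1 : G ≤ 1 := prod_le_one (fun p hp => (powClassFactor_nonneg_le_one (Nat.mem_primesLE.1 hp).2 n).1)
    fun p hp => (powClassFactor_nonneg_le_one (Nat.mem_primesLE.1 hp).2 n).2
  have hGC : G ≤ C / Real.log y ^ d := hC y hy2
  have hlogy0 : 0 < Real.log y := by linarith
  have hGℓ : G ≤ C / (ℓ / 2) ^ d := by
    refine hGC.trans (div_le_div_of_nonneg_left hC0.le (by positivity) ?_)
    exact pow_le_pow_left₀ (by positivity) hlogy d
  -- the key identity `F (T/L) (2/ℓ)^d = (2(d+8))^d w/L`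
  have hD0 : (0 : ℝ) < 2 * ((d : ℝ) + 8) := by positivity
  set D : ℝ := 2 * ((d : ℝ) + 8) with hD
  have hX0 : 0 < L * Real.log T / T := by positivity
  have hℓD : ℓ / 2 = (L * Real.log T / T) / D := by
    rw [hℓ, hD]; field_simp
  have hkey : F * ((2 * d + 2) * T / L) * (C / (ℓ / 2) ^ d) = K₁ * ((w : ℝ) / L) := by
    have hXd : (L * Real.log T / T) ^ d ≠ 0 := pow_ne_zero d hX0.ne'
    have hDd : D ^ d ≠ 0 := pow_ne_zero d hD0.ne'
    rw [hℓD, div_pow, hF, hK₁]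
    field_simp
  have hR₂card : (#R₂ : ℝ) ≤ (w : ℝ) / (8 * L) := by
    have hw0 : (0 : ℝ) ≤ w := Nat.cast_nonneg w
    have hA : 0 ≤ (w : ℝ) / (16 * L) := by positivity
    have hc0 : 0 ≤ (2 * (d : ℝ) + 2) * T / L := div_nonneg (mul_nonneg (by linarith) hT0.le) hL0.le
    have hB : 0 ≤ α * F * ((2 * d + 2) * T / L) := mul_nonneg hαF0 hc0
    calc (#R₂ : ℝ) ≤ #R₁ * G := hcs
      _ ≤ ((w : ℝ) / (16 * L) + u * ((2 * d + 2) * T / L)) * G :=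
          mul_le_mul_of_nonneg_right hR₁card hG0
      _ = (w : ℝ) / (16 * L) * G + u * ((2 * d + 2) * T / L) * G := by ring
      _ ≤ (w : ℝ) / (16 * L) * 1 + (α * F) * ((2 * d + 2) * T / L) * (C / (ℓ / 2) ^ d) := by
          refine add_le_add (mul_le_mul_of_nonneg_left hG1 hA) ?_
          exact mul_le_mul (mul_le_mul_of_nonneg_right huαF hc0) hGℓ hG0 hB
      _ = (w : ℝ) / (16 * L) + α * (F * ((2 * d + 2) * T / L) * (C / (ℓ / 2) ^ d)) := by ring
      _ = (w : ℝ) / (16 * L) + α * K₁ * ((w : ℝ) / L) := by rw [hkey]; ring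
      _ ≤ (w : ℝ) / (16 * L) + 1 / 16 * ((w : ℝ) / L) := by
          have hwL : (0 : ℝ) ≤ (w : ℝ) / L := div_nonneg hw0 hL0.le
          have := mul_le_mul_of_nonneg_right hαK hwL
          linarith
      _ = (w : ℝ) / (8 * L) := by field_simp; ring
  -- Stage 3: the large primes
  have hsubz : Nat.primesLE z ⊆ Nat.primesLE w := Nat.primesLE_mono (Nat.div_le_self w 4)
  have hcardPl : (#Pl : ℝ) = (Nat.primeCounting w : ℝ) - Nat.primeCounting z := by
    rw [hPl, card_sdiff_of_subset hsubz, Nat.cast_sub (card_le_card hsubz),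
      Nat.primesLE_card_eq_primeCounting, Nat.primesLE_card_eq_primeCounting]
  have hR₂Pl : #R₂ ≤ #Pl := by
    have hw0 : (0 : ℝ) ≤ w := Nat.cast_nonneg w
    have h1 : (w : ℝ) / (8 * L) ≤ (w : ℝ) / (4 * L) :=
      div_le_div_of_nonneg_left hw0 (by positivity) (by linarith)
    have : (#R₂ : ℝ) ≤ #Pl := by
      rw [hcardPl, hz]
      exact hR₂card.trans (h1.trans hπ)
    exact_mod_cast this
  obtain ⟨cl, hcl⟩ := exists_powClasses_of_card_le R₂ Pl
    (fun p hp => (Nat.mem_primesLE.1 (Finset.mem_sdiff.1 hp).1).2.pos) n hR₂Pl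
  -- assemble the classes
  refine ⟨fun p => if p ≤ y then cs p else if p ≤ z then 0 else cl p, fun m hm => ?_⟩
  have hmu : m ≤ u := Nat.le_floor hm
  have hmR₀ : m ∈ R₀ := mem_range.2 (by omega)
  by_cases h1 : m ∈ R₁
  · by_cases h2 : m ∈ R₂
    · -- a survivor of stages 1–2: covered by a large prime
      obtain ⟨p, hp, hdvd⟩ := hcl m h2
      rw [hPl, Finset.mem_sdiff, Nat.mem_primesLE, Nat.mem_primesLE] at hp
      obtain ⟨⟨hpw, hpp⟩, hnot⟩ := hp
      have hpz : ¬ p ≤ z := fun h => hnot ⟨h, hpp⟩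
      have hpy : ¬ p ≤ y := by omega
      refine ⟨p, hpp, hpw, ?_⟩
      show p ∣ m ^ n + (if p ≤ y then cs p else if p ≤ z then 0 else cl p)
      rw [if_neg hpy, if_neg hpz]
      exact hdvd
    · -- removed at stage 2: covered by a small prime
      rw [hR₂, mem_filter] at h2
      push Not at h2
      obtain ⟨p, hp, hdvd⟩ := h2 h1
      rw [hPs, Nat.mem_primesLE] at hp
      refine ⟨p, hp.2, ?_, ?_⟩
      · have := Nat.div_le_self w 4; omega
      · show p ∣ m ^ n + (if p ≤ y then cs p else if p ≤ z then 0 else cl p)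
        rw [if_pos hp.1]
        exact hdvd
  · -- removed at stage 1: a multiple of a medium prime
    rw [hR₁, mem_filter] at h1
    push Not at h1
    obtain ⟨p, hp, hdvd⟩ := h1 hmR₀
    rw [hPm, Finset.mem_sdiff, Nat.mem_primesLE, Nat.mem_primesLE] at hp
    obtain ⟨⟨hpz, hpp⟩, hnot⟩ := hp
    have hpy : ¬ p ≤ y := fun h => hnot ⟨h, hpp⟩
    refine ⟨p, hpp, hpz.trans (Nat.div_le_self w 4), ?_⟩
    show p ∣ m ^ n + (if p ≤ y then cs p else if p ≤ z then 0 else cl p)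
    rw [if_neg hpy, if_pos hpz, add_zero]
    exact dvd_pow hdvd (by omega)

end Literature.NumberTheory.Sieve.McCurley
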